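import Summits.BirchSwinnertonDyer.Rank1Residual.Iwasawa.LocalTowerKernelAtPGoodOrdinary
import Literature.NumberTheory.EllipticCurves.BSDRootNumberSmallConductorProofs
import HarnessLib

set_option linter.dupNamespace false -- `…BirchSwinnertonDyer.BirchSwinnertonDyer…` is the cell's nested layout (D-0017)
set_option autoImplicit false

/-!
# Greenberg LNM 1716 Lemma 3.4 at `n = 0`, step 7: the Frobenius-fixed reductions are `Ẽ(𝔽_p)`, so their `p`-primary
# part has `p^{ord_p #Ẽ(𝔽_p)}` elements

Seat `bsd-inputs-k4-p1` (gen 5; LADDER-BSD D-0154 KEY (147)(f) «prove the printed input», row 1 K4 INPUTS; Greenberg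
1999), `--supports stmt-BirchSwinnertonDyer-20309`. THEOREMS ONLY (no definition, no named fact, no `sorry`).

R. Greenberg, *Iwasawa theory for elliptic curves*, LNM 1716 (1999), §3 p. 89: for `F = ℚ` the prime `p` is totally
ramified in the cyclotomic tower, so the residue field `f_η` is `𝔽_p` and `|Ẽ(f_η)_p| = |Ẽ(𝔽_p)_p|`. In the tree's local
currency (cell bsd-2adic / b2b-bsdres: the spectral valuation `w` on `ℚ̄_v`, the model `W₀ = W_ℤ ⊗ 𝒪_w`, its reduction
map `red` to the points of `W₀ mod 𝔪_w` over the residue field `k_w ⊇ 𝔽_p`, an arithmetic Frobenius `τ`): a reduction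
`y = red Q` with `red (τ Q) = y` ("`τ`-fixed reduction", the image of `E(ℚ_v)` — Greenberg's `Ẽ(f)`) has coordinates
fixed by `x ↦ x^p` (`residueMap_pow_eq_of_reducePoint_smul_eq`), hence in `𝔽_p`; conversely a point with coordinates in
`𝔽_p` is the reduction of SOME `Q` (`reducePoint_surjective_of_isAlgClosed`) and then of `τQ` as well (the residue map
carries `τ` to the `p`-power map). Hence:

* `natCard_fixedReduction_primary_eq_pow` — for `W/ℚ` globally minimal and elliptic, `p ∤ Δ_W`, `v ∋ p`, `w` the spectral
  valuation, `𝔐` a prime of `\bar 𝓞_v` above `v` and `τ` an arithmetic Frobenius at `𝔐`: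
  **`#{y : y p-power torsion, y a τ-fixed reduction} = p^{ord_p (W.reductionPointCount p)}`** — the number
  `|Ẽ(𝔽_p)_p|` of Lemma 3.4 (`reductionPointCount W p = #Ẽ(𝔽_p)` of the minimal model).

HONEST FRAMING: a local TOOL theorem; closes nothing; no summit statement is proved; BSD is not proved by any of this.

References: [GreenbergLNM1716] §2 p. 70, §3 Lemma 3.4 (p. 89); [SilvermanAEC2009] VII.2.1; [SerreLocalFields1979] IV §4.
-/

set_option autoImplicit false

noncomputable section

open scoped Classical NNReal Polynomial

universe u

open Polynomial NumberField IsDedekindDomain Field IsDedekindDomain.HeightOneSpectrum WeierstrassCurve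
open Literature.NumberTheory.EllipticCurves Literature.NumberTheory.GaloisRepresentations
  Literature.NumberTheory.EllipticCurves.FormalGroupChart
  Summit.BirchSwinnertonDyer.Rank1Residual.Iwasawa.GoodOrdinary

namespace Summit.BirchSwinnertonDyer.BirchSwinnertonDyer.Theorems.InputsGreenbergLemma34

set_option maxHeartbeats 3200000 in
/-- **The `τ`-fixed reductions are `Ẽ(𝔽_p)`: `#{y p-power torsion, y = red Q = red(τQ)} = p^{ord_p #Ẽ(𝔽_p)}`.** For
`W/ℚ` globally minimal and elliptic with `p ∤ Δ_W`, `v ∋ p`, `w` the spectral valuation on `ℚ̄_v`, `W₀ = W_ℤ ⊗ 𝒪_w` with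
reduction `red Q = red_{W₀}(Q)` to `(W₀ mod 𝔪_w)(k_w)`, `𝔐` a prime of `\bar 𝓞_v` above `v` and `τ ∈ Γ_{ℚ_v}` an
arithmetic Frobenius at `𝔐`. The map `Ẽ(𝔽_p) → (W₀ mod 𝔪_w)(k_w)` (base change along `𝔽_p → k_w`) is an injective
homomorphism whose image is exactly the set of `τ`-fixed reductions; the count of the `p`-primary part follows
(`card_addPrimaryComponent_eq_pow`). [cite: GreenbergLNM1716, §2 p. 70 and §3 Lemma 3.4 (p. 89)]
[cite: SilvermanAEC2009, Prop. VII.2.1] -/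
theorem natCard_fixedReduction_primary_eq_pow (W : WeierstrassCurve ℚ) [W.IsElliptic] [W.IsGloballyMinimal] {p : ℕ}
    [hp : Fact p.Prime] {v : HeightOneSpectrum (𝓞 ℚ)} (hpv : ((p : ℕ) : 𝓞 ℚ) ∈ v.asIdeal)
    (hΔ : ¬ (p : ℤ) ∣ minimalDiscriminantInt W)
    {w : Valuation (AlgebraicClosure (v.adicCompletion ℚ)) ℝ≥0}
    (hw : ∀ x, (w x : ℝ) = spectralNorm (v.adicCompletion ℚ) (AlgebraicClosure (v.adicCompletion ℚ)) x)
    {𝔐 : Ideal v.localAbsIntegers} (h𝔐 : 𝔐 ∈ v.localPrimesAbove)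
    {τ : absoluteGaloisGroup (v.adicCompletion ℚ)} (hτ : IsArithFrobAt (v.adicCompletionIntegers ℚ) τ 𝔐) :
    Nat.card {y : (((integralModelInt W).map (algebraMap ℤ ↥w.valuationSubring)).map
        (IsLocalRing.residue ↥w.valuationSubring)).toAffine.Point //
      (∃ n : ℕ, p ^ n • y = 0) ∧ ∃ Q : localPoints W (v.adicCompletion ℚ),
        ((integralModelInt W).map (algebraMap ℤ ↥w.valuationSubring)).reducePoint
            (Affine.Point.congrEquiv (localIntModel_baseChange W w.valuationSubring).symm Q) = y ∧
          ((integralModelInt W).map (algebraMap ℤ ↥w.valuationSubring)).reducePoint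
            (Affine.Point.congrEquiv (localIntModel_baseChange W w.valuationSubring).symm (τ • Q)) = y} =
      p ^ padicValNat p (W.reductionPointCount p) := by
  -- notation and the standard set-up of the ordinary files
  let K := v.adicCompletion ℚ
  let Pt : Type := localPoints W K
  let W₀ : WeierstrassCurve ↥w.valuationSubring := (integralModelInt W).map (algebraMap ℤ ↥w.valuationSubring)
  let B : Type := (W₀.map (IsLocalRing.residue ↥w.valuationSubring)).toAffine.Point
  have hvO : w.Integers w.valuationSubring := Valuation.valuationSubring.integers w
  have hΔu : IsUnit W₀.Δ := W.isUnit_Δ_localIntModel hpv hw hΔ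
  have hMK : W₀.baseChange (AlgebraicClosure K) = W.baseChange (AlgebraicClosure K) := localIntModel_baseChange W w.valuationSubring
  let red : Pt → B := fun Q ↦ W₀.reducePoint (Affine.Point.congrEquiv hMK.symm Q)
  have hred : ∀ Q : Pt, red Q = W₀.reducePoint (Affine.Point.congrEquiv hMK.symm Q) := fun _ ↦ rfl
  -- the additive reduction map of the bsd-2adic files (same values)
  let red₀ : Pt →+ B := (goodReductionHom _ hvO hΔu).comp (Affine.Point.congrEquiv hMK.symm).toAddMonoidHom
  have hred₀ : ∀ P : Pt, red₀ P = W₀.reducePoint (Affine.Point.congrEquiv hMK.symm P) := fun P ↦ rfl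
  haveI hV : (W.baseChange (AlgebraicClosure K)).IsIntegral w.integer :=
    ⟨⟨(integralModelInt W).map (algebraMap ℤ ↥w.integer), W.baseChange_eq_localIntModel_integer_baseChange⟩⟩
  have hstab : ∀ (σ : absoluteGaloisGroup K) (Q : Pt), red₀ Q = 0 → red₀ (σ • Q) = 0 :=
    fun σ Q hQ ↦ (W.localRed_smul_eq_zero_iff hw hΔu red₀ hred₀ σ Q).mpr hQ
  -- the residue map `r : 𝒪_w → k̄`, `q = p`
  obtain ⟨r, hr, -, hrF⟩ := exists_residueMap (v := v) hw h𝔐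
  have hq : Nat.card (IsLocalRing.ResidueField (v.adicCompletionIntegers ℚ)) = p := by
    rw [natCard_residueField_adicCompletionIntegers v, Rat.HeightOneSpectrum.primesEquiv_eq_of_natCast_mem v hp.out hpv]
  set k := IsLocalRing.ResidueField (v.adicCompletionIntegers ℚ) with hk
  haveI : Finite k := finite_residueField_adicCompletionIntegers ℚ v
  haveI : Fintype k := Fintype.ofFinite k
  haveI hchark : CharP (AlgebraicClosure k) p := by
    refine (CharP.charP_iff_prime_eq_zero hp.out).mpr ?_
    have h1 : ((Nat.card k : ℕ) : AlgebraicClosure k) = 0 := by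
      rw [Nat.card_eq_fintype_card, ← map_natCast (algebraMap k (AlgebraicClosure k)), FiniteField.cast_card_eq_zero,
        map_zero]
    rwa [hq] at h1
  -- `r` factors through the residue field `k_w` of `𝒪_w`, injectively
  have hker : ∀ a ∈ IsLocalRing.maximalIdeal ↥w.valuationSubring, r a = 0 := by
    intro a ha
    rw [IsLocalRing.mem_maximalIdeal, mem_nonunits_iff, hvO.isUnit_iff_valuation_eq_one] at ha
    exact (hr a).mpr (lt_of_le_of_ne ((Valuation.mem_valuationSubring_iff w _).mp a.2) ha)
  let rt : IsLocalRing.ResidueField ↥w.valuationSubring →+* AlgebraicClosure k := Ideal.Quotient.lift (IsLocalRing.maximalIdeal ↥w.valuationSubring) r hker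
  have hrt : ∀ a, rt (IsLocalRing.residue ↥w.valuationSubring a) = r a := fun a ↦ Ideal.Quotient.lift_mk _ _ _
  have hrtinj : Function.Injective rt := RingHom.injective _
  -- `k_w` is an `𝔽_p`-algebra; the curve `W_ℤ mod p` over `𝔽_p` and its base change to `k_w`
  have hpO : w ((p : ℕ) : AlgebraicClosure K) < 1 := by
    have h := spectralValuation_algebraMap_ringOfIntegers_lt_one (v := v) hw hpv
    rwa [map_natCast] at h
  haveI hcharw : CharP (IsLocalRing.ResidueField ↥w.valuationSubring) p := by
    refine (CharP.charP_iff_prime_eq_zero hp.out).mpr ?_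
    rw [← map_natCast (IsLocalRing.residue ↥w.valuationSubring), IsLocalRing.residue_eq_zero_iff,
      IsLocalRing.mem_maximalIdeal, mem_nonunits_iff, hvO.isUnit_iff_valuation_eq_one, map_natCast]
    exact ne_of_lt hpO
  letI algw : Algebra (ZMod p) (IsLocalRing.ResidueField ↥w.valuationSubring) := ZMod.algebra _ p
  letI algk : Algebra (ZMod p) (AlgebraicClosure k) := ZMod.algebra _ p
  set Wp : WeierstrassCurve (ZMod p) := (integralModelInt W).map (Int.castRingHom (ZMod p)) with hWp
  have hcurve : W₀.map (IsLocalRing.residue ↥w.valuationSubring) = Wp.baseChange (IsLocalRing.ResidueField ↥w.valuationSubring) := by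
    change ((integralModelInt W).map (algebraMap ℤ ↥w.valuationSubring)).map (IsLocalRing.residue ↥w.valuationSubring) = _
    rw [hWp, WeierstrassCurve.map_map, WeierstrassCurve.baseChange, WeierstrassCurve.map_map]
    congr 1
    exact Subsingleton.elim _ _
  have e0 : Wp.baseChange (ZMod p) = Wp := by
    rw [WeierstrassCurve.baseChange, Algebra.algebraMap_self, WeierstrassCurve.map_id]
  have hrt_alg : ∀ i : ZMod p, rt (algebraMap (ZMod p) (IsLocalRing.ResidueField ↥w.valuationSubring) i) =
      algebraMap (ZMod p) (AlgebraicClosure k) i := fun i ↦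
    congrFun (congrArg DFunLike.coe (Subsingleton.elim (rt.comp (algebraMap (ZMod p) (IsLocalRing.ResidueField ↥w.valuationSubring)))
      (algebraMap (ZMod p) (AlgebraicClosure k)))) i
  -- the injective homomorphism `ι : Ẽ(𝔽_p) → (W₀ mod 𝔪_w)(k_w)`
  have hofinj : Function.Injective (Algebra.ofId (ZMod p) (IsLocalRing.ResidueField ↥w.valuationSubring)) :=
    (algebraMap (ZMod p) (IsLocalRing.ResidueField ↥w.valuationSubring)).injective
  let ι : Wp.toAffine.Point →+ B :=
    ((Affine.Point.congrEquiv hcurve.symm).toAddMonoidHom.comp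
      (Affine.Point.map (W' := Wp) (Algebra.ofId (ZMod p) (IsLocalRing.ResidueField ↥w.valuationSubring)))).comp
      (Affine.Point.congrEquiv e0).symm.toAddMonoidHom
  have hιinj : Function.Injective ι :=
    (Affine.Point.congrEquiv hcurve.symm).injective.comp
      ((Affine.Point.map_injective _).comp (Affine.Point.congrEquiv e0).symm.injective)
  have hιsome : ∀ (i j : ZMod p) (h₀ : (Wp.baseChange (ZMod p)).toAffine.Nonsingular i j),
      ∃ hns, ι (Affine.Point.congrEquiv e0 (Affine.Point.some i j h₀)) =
        Affine.Point.some (algebraMap (ZMod p) (IsLocalRing.ResidueField ↥w.valuationSubring) i)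
          (algebraMap (ZMod p) (IsLocalRing.ResidueField ↥w.valuationSubring) j) hns := by
    intro i j h₀
    have hns : (W₀.map (IsLocalRing.residue ↥w.valuationSubring)).toAffine.Nonsingular
        (algebraMap (ZMod p) (IsLocalRing.ResidueField ↥w.valuationSubring) i) (algebraMap (ZMod p) (IsLocalRing.ResidueField ↥w.valuationSubring) j) := by
      rw [hcurve]
      exact (Wp.toAffine.baseChange_nonsingular (f := Algebra.ofId (ZMod p) (IsLocalRing.ResidueField ↥w.valuationSubring))
        hofinj i j).mpr h₀
    refine ⟨hns, ?_⟩
    change Affine.Point.congrEquiv hcurve.symm (Affine.Point.map (W' := Wp)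
      (Algebra.ofId (ZMod p) (IsLocalRing.ResidueField ↥w.valuationSubring))
        ((Affine.Point.congrEquiv e0).symm (Affine.Point.congrEquiv e0 (Affine.Point.some i j h₀)))) = _
    rw [AddEquiv.symm_apply_apply, Affine.Point.map_some, Affine.Point.congrEquiv_some, Affine.Point.some.injEq]
    exact ⟨rfl, rfl⟩
  -- (A) every `τ`-fixed reduction is in the image of `ι`
  have hsurjι : ∀ y : B, (∃ Q : Pt, red Q = y ∧ red (τ • Q) = y) → ∃ P₀, ι P₀ = y := by
    rintro y ⟨Q, hQ, hτQ⟩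
    by_cases hy0 : y = 0
    · exact ⟨0, by rw [map_zero, hy0]⟩
    have hredQ : red Q ≠ 0 := by rw [hQ]; exact hy0
    -- `Q = (x, y₁)` with `x` integral
    obtain ⟨x, y₁, h, hPxy⟩ : ∃ x y₁ h, Q = Affine.Point.some x y₁ h := by
      have hP0 : Q ≠ 0 := fun h0 ↦ hredQ (by rw [h0]; exact (map_zero red₀ : red₀ 0 = 0))
      revert hP0
      change ∀ _ : (show (W.baseChange (AlgebraicClosure K)).toAffine.Point from Q) ≠ 0, _
      rcases Q with _ | ⟨x, y₁, h⟩
      · intro h0; exact absurd Affine.Point.zero_def h0.symm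
      · intro; exact ⟨x, y₁, h, rfl⟩
    have hx : w x ≤ 1 := by
      by_contra hx
      apply hredQ
      have h0 : red₀ Q = 0 := (W.localRed_eq_zero_iff_mem_kernel hΔu red₀ hred₀ Q).mpr
        (by rw [hPxy]; exact (some_mem_kernel_iff (w := w) h).mpr (not_le.mp hx))
      exact h0
    have heq : W₀.reducePoint (Affine.Point.congrEquiv hMK.symm (τ • Q)) =
        W₀.reducePoint (Affine.Point.congrEquiv hMK.symm Q) := by
      change red (τ • Q) = red Q; rw [hτQ, hQ]
    obtain ⟨hy₁, hxq, hyq⟩ := residueMap_pow_eq_of_reducePoint_smul_eq hw hr hrF hτ hΔu hMK hx hPxy heq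
    rw [hq] at hxq hyq
    obtain ⟨i, hi⟩ := exists_zmod_cast_eq_of_pow_eq (L := AlgebraicClosure k) hxq
    obtain ⟨j, hj⟩ := exists_zmod_cast_eq_of_pow_eq (L := AlgebraicClosure k) hyq
    -- the reduced point in coordinates
    obtain ⟨hy', hns, eR⟩ := reducePoint_congrEquiv_some_of_val_le_one hΔu hMK x y₁ h hx
    have hxi : IsLocalRing.residue ↥w.valuationSubring ⟨x, hx⟩ =
        algebraMap (ZMod p) (IsLocalRing.ResidueField ↥w.valuationSubring) i :=
      hrtinj ((hrt ⟨x, hx⟩).trans (hi.symm.trans (hrt_alg i).symm))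
    have hyj : IsLocalRing.residue ↥w.valuationSubring ⟨y₁, hy'⟩ =
        algebraMap (ZMod p) (IsLocalRing.ResidueField ↥w.valuationSubring) j :=
      hrtinj ((hrt ⟨y₁, hy'⟩).trans (hj.symm.trans (hrt_alg j).symm))
    -- the `𝔽_p`-point
    have h₁ : (Wp.baseChange (IsLocalRing.ResidueField ↥w.valuationSubring)).toAffine.Nonsingular
        (algebraMap (ZMod p) (IsLocalRing.ResidueField ↥w.valuationSubring) i)
        (algebraMap (ZMod p) (IsLocalRing.ResidueField ↥w.valuationSubring) j) := by
      have h' : (W₀.map (IsLocalRing.residue ↥w.valuationSubring)).toAffine.Nonsingular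
          (algebraMap (ZMod p) (IsLocalRing.ResidueField ↥w.valuationSubring) i)
          (algebraMap (ZMod p) (IsLocalRing.ResidueField ↥w.valuationSubring) j) := hxi ▸ hyj ▸ hns
      exact hcurve ▸ h'
    have h₀ : (Wp.baseChange (ZMod p)).toAffine.Nonsingular i j :=
      (Wp.toAffine.baseChange_nonsingular (f := Algebra.ofId (ZMod p) (IsLocalRing.ResidueField ↥w.valuationSubring)) hofinj i j).mp h₁
    obtain ⟨hns', hι⟩ := hιsome i j h₀
    refine ⟨Affine.Point.congrEquiv e0 (Affine.Point.some i j h₀), ?_⟩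
    have eRQ : red Q = W₀.reducePoint (Affine.Point.congrEquiv hMK.symm (Affine.Point.some x y₁ h)) := by
      rw [hred, hPxy]
    calc ι (Affine.Point.congrEquiv e0 (Affine.Point.some i j h₀))
        = Affine.Point.some (algebraMap (ZMod p) (IsLocalRing.ResidueField ↥w.valuationSubring) i)
            (algebraMap (ZMod p) (IsLocalRing.ResidueField ↥w.valuationSubring) j) hns' := hι
      _ = Affine.Point.some (IsLocalRing.residue ↥w.valuationSubring ⟨x, hx⟩)
            (IsLocalRing.residue ↥w.valuationSubring ⟨y₁, hy'⟩) hns := point_some_congr hxi.symm hyj.symm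
      _ = y := (eRQ.trans eR).symm.trans hQ
  -- (B) the image of `ι` consists of `τ`-fixed reductions
  have hfixι : ∀ P₀ : Wp.toAffine.Point, ∃ Q : Pt, red Q = ι P₀ ∧ red (τ • Q) = ι P₀ := by
    intro P₀
    -- a lift `Q` of `ι P₀`
    obtain ⟨Q', hQ'⟩ := reducePoint_surjective_of_isAlgClosed w.valuationSubring W₀ hΔu (ι P₀)
    let Q : Pt := (Affine.Point.congrEquiv hMK.symm).symm Q'
    have hQ : red Q = ι P₀ := by
      rw [hred]
      change W₀.reducePoint ((Affine.Point.congrEquiv hMK.symm) ((Affine.Point.congrEquiv hMK.symm).symm Q')) = ι P₀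
      rw [AddEquiv.apply_symm_apply]; exact hQ'
    refine ⟨Q, hQ, ?_⟩
    -- the point `P₀` in coordinates
    obtain ⟨P₁, rfl⟩ := (Affine.Point.congrEquiv e0).surjective P₀
    rcases P₁ with _ | ⟨i, j, h₀⟩
    · -- `P₀ = 0`: `red Q = 0`, hence `red (τQ) = 0`
      have h0 : ι (Affine.Point.congrEquiv e0 Affine.Point.zero) = 0 := by
        rw [← Affine.Point.zero_def, map_zero, map_zero]
      rw [h0] at hQ ⊢
      exact hstab τ Q hQ
    obtain ⟨hns', hι⟩ := hιsome i j h₀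
    have hy0 : ι (Affine.Point.congrEquiv e0 (Affine.Point.some i j h₀)) ≠ 0 := by
      rw [hι]; exact fun h ↦ by cases h
    have hredQ : red Q ≠ 0 := by rw [hQ]; exact hy0
    obtain ⟨x, y₁, h, hPxy⟩ : ∃ x y₁ h, Q = Affine.Point.some x y₁ h := by
      have hP0 : Q ≠ 0 := fun h0 ↦ hredQ (by rw [h0]; exact (map_zero red₀ : red₀ 0 = 0))
      revert hP0
      change ∀ _ : (show (W.baseChange (AlgebraicClosure K)).toAffine.Point from Q) ≠ 0, _
      rcases Q with _ | ⟨x, y₁, h⟩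
      · intro h0; exact absurd Affine.Point.zero_def h0.symm
      · intro; exact ⟨x, y₁, h, rfl⟩
    have hx : w x ≤ 1 := by
      by_contra hx
      apply hredQ
      have h0 : red₀ Q = 0 := (W.localRed_eq_zero_iff_mem_kernel hΔu red₀ hred₀ Q).mpr
        (by rw [hPxy]; exact (some_mem_kernel_iff (w := w) h).mpr (not_le.mp hx))
      exact h0
    obtain ⟨hy', hns, eR⟩ := reducePoint_congrEquiv_some_of_val_le_one hΔu hMK x y₁ h hx
    -- the coordinates of `red Q` are those of `P₀`
    have hcoord : IsLocalRing.residue ↥w.valuationSubring ⟨x, hx⟩ =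
          algebraMap (ZMod p) (IsLocalRing.ResidueField ↥w.valuationSubring) i ∧
        IsLocalRing.residue ↥w.valuationSubring ⟨y₁, hy'⟩ =
          algebraMap (ZMod p) (IsLocalRing.ResidueField ↥w.valuationSubring) j := by
      have eRQ : red Q = W₀.reducePoint (Affine.Point.congrEquiv hMK.symm (Affine.Point.some x y₁ h)) := by
        rw [hred, hPxy]
      have h2 : Affine.Point.some (algebraMap (ZMod p) (IsLocalRing.ResidueField ↥w.valuationSubring) i)
            (algebraMap (ZMod p) (IsLocalRing.ResidueField ↥w.valuationSubring) j) hns' =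
          Affine.Point.some (IsLocalRing.residue ↥w.valuationSubring ⟨x, hx⟩)
            (IsLocalRing.residue ↥w.valuationSubring ⟨y₁, hy'⟩) hns := hι.symm.trans (hQ.symm.trans (eRQ.trans eR))
      obtain ⟨h2x, h2y⟩ := Affine.Point.some.inj h2
      exact ⟨h2x.symm, h2y.symm⟩
    -- `τQ = (τx, τy₁)` with integral `τx`, and its reduction
    have hτx : w (τ • x) ≤ 1 := by rwa [spectralValuation_smul hw]
    have hτy : w (τ • y₁) ≤ 1 := by rwa [spectralValuation_smul hw]
    obtain ⟨hτ', hτQ⟩ : ∃ h', τ • Q = Affine.Point.some (τ • x) (τ • y₁) h' := by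
      rw [hPxy, localPoints.smul_def, Affine.Point.map_some]
      exact ⟨_, rfl⟩
    obtain ⟨hτy', hnsτ, eRτ⟩ := reducePoint_congrEquiv_some_of_val_le_one hΔu hMK (τ • x) (τ • y₁) hτ' hτx
    -- Frobenius on the residues: `r(τ z) = r(z)^p = r(z)` for `r(z) ∈ 𝔽_p`
    have hfrob : ∀ (z : AlgebraicClosure K) (hz : w z ≤ 1) (hτz : w (τ • z) ≤ 1) (c : ZMod p),
        IsLocalRing.residue ↥w.valuationSubring ⟨z, hz⟩ = algebraMap (ZMod p) (IsLocalRing.ResidueField ↥w.valuationSubring) c →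
        IsLocalRing.residue ↥w.valuationSubring ⟨τ • z, hτz⟩ = IsLocalRing.residue ↥w.valuationSubring ⟨z, hz⟩ := by
      intro z hz hτz c hc
      apply hrtinj
      have h1 : rt (IsLocalRing.residue ↥w.valuationSubring ⟨τ • z, hτz⟩) = r ⟨z, hz⟩ ^ p :=
        (hrt ⟨τ • z, hτz⟩).trans ((hrF hτ ⟨z, hz⟩ hτz).trans (by rw [hq]))
      have h2 : r ⟨z, hz⟩ = algebraMap (ZMod p) (AlgebraicClosure k) c :=
        (hrt ⟨z, hz⟩).symm.trans ((congrArg rt hc).trans (hrt_alg c))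
      have h3 : rt (IsLocalRing.residue ↥w.valuationSubring ⟨z, hz⟩) = algebraMap (ZMod p) (AlgebraicClosure k) c :=
        (hrt ⟨z, hz⟩).trans h2
      rw [h1, h3, h2, ← map_pow, ZMod.pow_card]
    have eRτQ : red (τ • Q) =
        W₀.reducePoint (Affine.Point.congrEquiv hMK.symm (Affine.Point.some (τ • x) (τ • y₁) hτ')) := by
      rw [hred, hτQ]
    calc red (τ • Q)
        = Affine.Point.some (IsLocalRing.residue ↥w.valuationSubring ⟨τ • x, hτx⟩)
            (IsLocalRing.residue ↥w.valuationSubring ⟨τ • y₁, hτy'⟩) hnsτ := eRτQ.trans eRτ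
      _ = Affine.Point.some (algebraMap (ZMod p) (IsLocalRing.ResidueField ↥w.valuationSubring) i)
            (algebraMap (ZMod p) (IsLocalRing.ResidueField ↥w.valuationSubring) j) hns' :=
          point_some_congr ((hfrob x hx hτx i hcoord.1).trans hcoord.1) ((hfrob y₁ hy' hτy' j hcoord.2).trans hcoord.2)
      _ = ι (Affine.Point.congrEquiv e0 (Affine.Point.some i j h₀)) := hι.symm
  -- (C) counting: the subtype is in bijection with the `p`-primary component of `Ẽ(𝔽_p)`
  have e1 : {y : B // (∃ n : ℕ, p ^ n • y = 0) ∧ ∃ Q : Pt, red Q = y ∧ red (τ • Q) = y} ≃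
      AddCommGroup.primaryComponent Wp.toAffine.Point p :=
    { toFun := fun y ↦ ⟨(hsurjι y.1 y.2.2).choose, (AddCommGroup.mem_primaryComponent).mpr (by
        obtain ⟨n, hn⟩ := y.2.1
        refine ⟨n, hιinj ?_⟩
        rw [map_nsmul, (hsurjι y.1 y.2.2).choose_spec, hn, map_zero])⟩
      invFun := fun P ↦ ⟨ι P.1, by
        obtain ⟨n, hn⟩ := (AddCommGroup.mem_primaryComponent).mp P.2
        exact ⟨⟨n, by rw [← map_nsmul, hn, map_zero]⟩, hfixι P.1⟩⟩
      left_inv := fun y ↦ Subtype.ext (hsurjι y.1 y.2.2).choose_spec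
      right_inv := fun P ↦ Subtype.ext (hιinj (hsurjι (ι P.1) (hfixι P.1)).choose_spec) }
  rw [Nat.card_congr e1, card_addPrimaryComponent_eq_pow, Nat.factorization_def _ hp.out]
  rfl

end Summit.BirchSwinnertonDyer.BirchSwinnertonDyer.Theorems.InputsGreenbergLemma34

end
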